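import Literature.NumberTheory.Rogawski1990.ArchOrbFamGExtCentralJetModel   -- ★ p851263 (A-p12 (g28)) J1: `bddAbove_image_inter_of_dense`; brings ★ (B2) `exists_nhds_bddAbove_norm_iteratedFDeriv_mul_of_contDiffOn`, `bddAbove_norm_iteratedFDeriv_comp_clm_image`, ★ `dense_regG`, `RegG`, `InRegG`
import HarnessLib

/-!
# The GENERIC junction «AFFINE CHART MODEL on the regular set ⇒ jet bounds on the inner-regular set»: a function that equals `u(c) · Ψ(A c + p₀)` on `U ∩ RegG S′`, `Ψ` smooth with
# bounded jets on the chart image, has every jet bounded near `x` on `InRegG` (Varadarajan 1977 I §1.12; Bouaziz 1994 §3.1 (I₁); Hörmander ALPDO I §1.1)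

Topic `NumberTheory/Rogawski1990`; namespace `Literature.NumberTheory.Rogawski1990`.  THEOREMS ONLY (no `def`, no instance, no notation, no axiom, no named fact, no `sorry`).  Cell
`pub/hodgecm-mathlib`, crux H413 (`stmt-HodgeConjecture-24833`), F0∕P3c line LH3 (leaf `F0_P3c_StubN9Direct` v5.1), organ **O-L1d′ `stub_N9hcCentralMixedJetBounds`** (LH3-plan (g4) RULING #19:
(hCm-ASM) → F0P3a-p08 (g23)); brick «J1-MIXED, model-agnostic half».  It is STEPS 4–7 of ★ J1 `exists_nhds_bddAbove_norm_iteratedFDeriv_orbFamGExt_of_centralModel` (A-p12 (g28)) with the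
central integral replaced by an ARBITRARY chart model `Ψ` on an ARBITRARY finite-dimensional chart space `Y` — so the MIXED organ feeds it the two-stage tower of ★ (E5)
`contDiffOn_and_forall_bound_twoStage_nestedBlockReaders` (faces: ★ p851216∕p851218 + ★ p851247; scalar places: ★ p851275 + ★ p851321) read through the affine chart
`c ↦ (A c, (ψ_k(c))_k, (θ_k(c))_k)`, and any other stratum feeds its own model.
HEAD **`exists_nhds_bddAbove_norm_iteratedFDeriv_of_chartModel`**: `F : (W → Fin 3 → ℝ) → ℂ` `C^∞` on the open `InRegG s S′` (`h1`); an affine chart `c ↦ Ach c + p₀` into `Y`; `Ψ : Y → ℂ` smooth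
on an open `O′` with, for every order, its jets bounded on a set `R ⊆ O′`; an open `U₀ ∋ x` whose `G`-regular points are charted into `R`; a smooth unit `u` on `U ∈ 𝓝 x`; and the model
identity `F c = u c · Ψ (Ach c + p₀)` on `U ∩ U₀ ∩ RegG S′`.  THEN `∃ U′ ∈ 𝓝 x, BddAbove (‖Dⁿ F‖ '' (U′ ∩ InRegG s S′))`: pull back the jets of `Ψ` along the chart (★ `bddAbove_norm_iteratedFDeriv_comp_clm_image`
after the translation `iteratedFDeriv_comp_add_right`), Leibniz with `u` (★ `exists_nhds_bddAbove_norm_iteratedFDeriv_mul_of_contDiffOn`), identify `F` with the model on the OPEN set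
`interior U ∩ U₀ ∩ RegG S′` (so the jets agree there), and pass from the dense `RegG S′` (★ `dense_regG`) to `InRegG s S′` by the continuity of `Dⁿ F` on the open `InRegG` (★ `bddAbove_image_inter_of_dense`)
— across the compact and real walls.
HONEST LABEL: count-neutral; HC_CM is proved only modulo the 7 printed citations (2 remaining: hLiu418 = stmt-HodgeConjecture-24832, h413 = stmt-HodgeConjecture-24833) until rung 0 closes.

## References
* [Varadarajan1977] V. S. Varadarajan, *Harmonic Analysis on Real Reductive Groups*, LNM 576 (1977), Part I §1.12 (`'F_f` on `T_{in-reg}`).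
* [Bouaziz1994IntegralesOrbitales] A. Bouaziz, *Intégrales orbitales sur les groupes de Lie réductifs*, Ann. Sci. ÉNS 27 (1994), §3.1 (I₁)–(I₂) p. 579.
* [HormanderALPDO1] L. Hörmander, *The Analysis of Linear Partial Differential Operators I*, 2nd ed. (1990), §1.1 Thms. 1.1.8, 1.1.9.
-/

set_option autoImplicit false

noncomputable section

open Set Filter Topology Function Metric
open Literature.NumberTheory.Automorphic Literature.NumberTheory.Automorphic.ArchCartan Literature.Analysis.Calculus
open scoped ContDiff Classical

namespace Literature.NumberTheory.Rogawski1990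

section ChartModel

variable {W : Type*} [Fintype W]

/-- **AFFINE CHART MODEL ON `RegG` ⇒ JET BOUNDS ON `InRegG`.**  See the module docstring: `F = u · (Ψ ∘ (Ach · + p₀))` on `U ∩ U₀ ∩ RegG S′` with `Ψ` smooth on the open `O′` and
`‖Dᵏ Ψ‖` bounded on `R ⊆ O′` (all `k`), the chart sending `U₀ ∩ RegG S′` into `R`, `u` smooth on `U ∈ 𝓝 x`, and `F` smooth on the open `InRegG s S′` ⇒
`∃ U′ ∈ 𝓝 x, BddAbove (‖Dⁿ F‖ '' (U′ ∩ InRegG s S′))`. [cite: Varadarajan1977, Part I §1.12] [cite: Bouaziz1994IntegralesOrbitales, §3.1 (I₁)–(I₂) p. 579] [cite: HormanderALPDO1, §1.1 Thms. 1.1.8, 1.1.9] -/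
theorem exists_nhds_bddAbove_norm_iteratedFDeriv_of_chartModel (s : W → Fin 3 → SignType) (S' : Finset W)
    (F : (W → Fin 3 → ℝ) → ℂ) (h1 : ContDiffOn ℝ ∞ F (InRegG s S')) {x : W → Fin 3 → ℝ}
    {Y : Type*} [NormedAddCommGroup Y] [NormedSpace ℝ Y] (Ach : (W → Fin 3 → ℝ) →L[ℝ] Y) (p₀ : Y)
    {O' : Set Y} (hO' : IsOpen O') (Ψ : Y → ℂ) (hΨ : ContDiffOn ℝ ∞ Ψ O')
    (R : Set Y) (hRO : R ⊆ O') (hΨb : ∀ k : ℕ, ∃ B : ℝ, ∀ z ∈ R, ‖iteratedFDeriv ℝ k Ψ z‖ ≤ B)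
    {U₀ : Set (W → Fin 3 → ℝ)} (hU₀ : IsOpen U₀) (hxU₀ : x ∈ U₀) (hmaps : ∀ c ∈ U₀ ∩ RegG S', Ach c + p₀ ∈ R)
    {U : Set (W → Fin 3 → ℝ)} (hU : U ∈ 𝓝 x) (u : (W → Fin 3 → ℝ) → ℂ) (hu : ContDiffOn ℝ ∞ u U)
    (hfac : ∀ c ∈ U ∩ U₀ ∩ RegG S', F c = u c * Ψ (Ach c + p₀)) (n : ℕ) :
    ∃ U' ∈ 𝓝 x, BddAbove ((fun c => ‖iteratedFDeriv ℝ n F c‖) '' (U' ∩ InRegG s S')) := by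
  -- the translated model `H₂ y = Ψ (y + p₀)` on the open `O₂ = (· + p₀) ⁻¹' O'`
  obtain ⟨H₂, hH₂def⟩ : ∃ H₂ : Y → ℂ, H₂ = fun y => Ψ (y + p₀) := ⟨_, rfl⟩
  set O₂ : Set Y := (fun y => y + p₀) ⁻¹' O' with hO₂
  have hO₂o : IsOpen O₂ := hO'.preimage (continuous_id.add continuous_const)
  have hH₂s : ContDiffOn ℝ ∞ H₂ O₂ := by
    rw [hH₂def]; exact hΨ.comp (contDiffOn_id.add contDiffOn_const) fun y hy => hy
  have hH₂j : ∀ (k : ℕ) (y : Y), iteratedFDeriv ℝ k H₂ y = iteratedFDeriv ℝ k Ψ (y + p₀) := fun k y => by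
    rw [hH₂def, iteratedFDeriv_comp_add_right]
  -- the off-wall open set `Oc = (interior U ∩ U₀) ∩ RegG S′`
  set Oc : Set (W → Fin 3 → ℝ) := (interior U ∩ U₀) ∩ RegG S' with hOc
  have hOco : IsOpen Oc := (isOpen_interior.inter hU₀).inter (isOpen_regG S')
  have hmaps' : MapsTo Ach Oc O₂ := fun c hc => by
    show Ach c + p₀ ∈ O'
    exact hRO (hmaps c ⟨hc.1.2, hc.2⟩)
  -- jets of the pulled-back model `H₂ ∘ Ach` on `Oc`
  have hHb : ∀ k ≤ n, ∃ U'' ∈ 𝓝 x, BddAbove ((fun c => ‖iteratedFDeriv ℝ k (H₂ ∘ Ach) c‖) '' (U'' ∩ Oc)) := by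
    intro k _
    obtain ⟨B, hB⟩ := hΨb k
    refine ⟨univ, univ_mem, ?_⟩
    rw [univ_inter]
    refine bddAbove_norm_iteratedFDeriv_comp_clm_image Ach hO₂o (hH₂s.of_le (mod_cast le_top)) hmaps' ⟨B, ?_⟩
    rintro _ ⟨_, ⟨c, hc, rfl⟩, rfl⟩
    show ‖iteratedFDeriv ℝ k H₂ (Ach c)‖ ≤ B
    rw [hH₂j]
    exact hB _ (hmaps c ⟨hc.1.2, hc.2⟩)
  -- Leibniz with the unit `u`
  have huV : ContDiffOn ℝ ∞ u (interior U) := hu.mono interior_subset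
  obtain ⟨U₁, hU₁, hB₁⟩ := exists_nhds_bddAbove_norm_iteratedFDeriv_mul_of_contDiffOn isOpen_interior (mem_interior_iff_mem_nhds.2 hU) huV hOco
    ((hH₂s.comp Ach.contDiff.contDiffOn hmaps').of_le (mod_cast le_top)) hHb
  -- on the open `Oc` the function IS the model, so the jets agree there
  have hEq : ∀ c ∈ Oc, F c = u c * (H₂ ∘ Ach) c := fun c hc => by
    rw [hfac c ⟨⟨interior_subset hc.1.1, hc.1.2⟩, hc.2⟩, comp_apply, hH₂def]
  have hEqj : ∀ c ∈ Oc, iteratedFDeriv ℝ n F c = iteratedFDeriv ℝ n (fun c => u c * (H₂ ∘ Ach) c) c := by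
    intro c hc
    have hev : F =ᶠ[𝓝 c] fun c => u c * (H₂ ∘ Ach) c := Filter.eventuallyEq_of_mem (hOco.mem_nhds hc) fun y hy => hEq y hy
    exact (hev.iteratedFDeriv ℝ n).eq_of_nhds
  -- the bound on `U₂ ∩ RegG S′` passes to `U₂ ∩ InRegG s S′` by density and the continuity of the jets on the open `InRegG`
  set U₂ : Set (W → Fin 3 → ℝ) := interior U₁ ∩ (interior U ∩ U₀) with hU₂
  have hU₂o : IsOpen U₂ := isOpen_interior.inter (isOpen_interior.inter hU₀)
  have hxU₂ : x ∈ U₂ := ⟨mem_interior_iff_mem_nhds.2 hU₁, mem_interior_iff_mem_nhds.2 hU, hxU₀⟩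
  have hcontn : ContinuousOn (fun c => ‖iteratedFDeriv ℝ n F c‖) (InRegG s S') := by
    have hV := isOpen_inRegG s S'
    refine ContinuousOn.norm ?_
    exact (h1.continuousOn_iteratedFDerivWithin (m := n) (mod_cast le_top) hV.uniqueDiffOn).congr
      fun c hc => (iteratedFDerivWithin_of_isOpen n hV hc).symm
  refine ⟨U₂, hU₂o.mem_nhds hxU₂, ?_⟩
  refine bddAbove_image_inter_of_dense hU₂o (isOpen_inRegG s S') hcontn (dense_regG S') (hB₁.mono ?_)
  rintro _ ⟨c, ⟨⟨hcU₂, -⟩, hcreg⟩, rfl⟩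
  have hcOc : c ∈ Oc := ⟨hcU₂.2, hcreg⟩
  refine ⟨c, ⟨interior_subset hcU₂.1, hcOc⟩, ?_⟩
  show ‖iteratedFDeriv ℝ n (fun y => u y * (H₂ ∘ Ach) y) c‖ = ‖iteratedFDeriv ℝ n F c‖
  rw [hEqj c hcOc]

end ChartModel

end Literature.NumberTheory.Rogawski1990

end
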